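import Literature.NumberTheory.EllipticCurves.BoxerDiao2010.TwoSelmerTwists
import Mathlib.GroupTheory.Perm.Cycle.Type
import HarnessLib

/-!
# Track U2, route A (cell `bsd-uniform`, seat u2-p1): the DICTIONARY «2-trivial ⟺ `a_q` odd» PROVED —
# Boxer–Diao's "no rational `2`-torsion mod `q`" is Kriz–Li's / the cell's "`a_q(E)` odd"

HONEST FRAMING (cell `bsd-uniform`, HOME run/shared/lean/pub/bsd-uniform/, verbatim in every file of
the seat): bookkeeping only — no arithmetic input, nothing booked, no per-curve certificate counted as
uniform. HOME/u2/INGREDIENTS.md §7 F9 records that the twisting condition of the «a_q-odd combination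
at 2» is printed in several dialects: Boxer–Diao 2010 ("`E` has no rational `2`-torsion mod `p`",
typed as `BoxerDiao2010.IsTwoTrivial`), Kriz–Li 2019 / the cell's `𝒮′` ("`a_ℓ(E)` odd", typed as
`Odd (W.frobeniusTrace ℓ)` in `KrizLi2019.InS`), Zhai 2016 ("`q` inert in the cubic field `F`",
`Zhai2016.IsInertIn`). This file PROVES the equivalence of the first two from the tree's own definition
`frobeniusTrace W q = q + 1 − #Ẽ(𝔽_q)` (`GlobalMinimalModel.lean`) and finite-group theory (Lagrange /
Cauchy): for an odd prime `q`, `a_q` is odd iff `#Ẽ(𝔽_q)` is odd iff `Ẽ(𝔽_q)` has no element of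
order `2`. (The third dialect — inertness in the cubic field — needs Dedekind–Kummer for the
`2`-division cubic and is not treated.) Consumers: `TransportARankZeroBoxerDiao` can take its
`IsTwoTrivial` binder in the `a_q`-odd form.

## Contents
* `forall_two_nsmul_eq_zero_iff_odd_card` — finite additive group: no element of order `2` iff odd order.
* `odd_frobeniusTrace_iff_odd_reductionPointCount` — `q` odd: `a_q` odd iff `#Ẽ(𝔽_q)` odd.
* `isTwoTrivial_iff_forall_odd_frobeniusTrace` — THE DICTIONARY.

References: Boxer–Diao 2010 p. 1971 (definition of 2-trivial) [BoxerDiao2010]; Kriz–Li 2019 Def. 4.1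
(FMS) and p0014 L57–L58 ("since `Frob_ℓ` is order 3 on `E[2]`, `a_ℓ(E) ≡ 1 (mod 2)`") [KrizLi2019].
-/

noncomputable section

open scoped Classical

open WeierstrassCurve Literature.NumberTheory.EllipticCurves

namespace Summit.BirchSwinnertonDyer.Uniform.U2

/-! ## §1 Finite groups: no `2`-torsion iff odd order -/

/-- In a finite additive group, every element killed by `2` is trivial iff the order of the group
is odd (Lagrange one way, Cauchy the other). [folklore] -/
theorem forall_two_nsmul_eq_zero_iff_odd_card {G : Type*} [AddCommGroup G] [Finite G] :
    (∀ x : G, (2 : ℕ) • x = 0 → x = 0) ↔ Odd (Nat.card G) := by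
  haveI : Fact (2 : ℕ).Prime := ⟨Nat.prime_two⟩
  constructor
  · intro h
    by_contra hodd
    have heven : 2 ∣ Nat.card G := even_iff_two_dvd.mp (Nat.not_odd_iff_even.mp hodd)
    haveI : Fintype G := Fintype.ofFinite G
    rw [Nat.card_eq_fintype_card] at heven
    obtain ⟨x, hx⟩ := exists_prime_addOrderOf_dvd_card 2 heven
    have h2x : (2 : ℕ) • x = 0 := by rw [← hx]; exact addOrderOf_nsmul_eq_zero x
    have hx0 := h x h2x
    rw [hx0, addOrderOf_zero] at hx
    exact absurd hx (by norm_num)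
  · intro hodd x hx
    have h1 : addOrderOf x ∣ 2 := addOrderOf_dvd_of_nsmul_eq_zero hx
    have h2 : addOrderOf x ∣ Nat.card G := addOrderOf_dvd_natCard x
    have hne : addOrderOf x ≠ 2 := fun h => by
      rw [h] at h2
      exact (Nat.not_even_iff_odd.mpr hodd) (even_iff_two_dvd.mpr h2)
    have h1' : addOrderOf x = 1 := by
      rcases (Nat.dvd_prime Nat.prime_two).mp h1 with h | h
      · exact h
      · exact absurd h hne
    exact AddMonoid.addOrderOf_eq_one_iff.mp h1'

/-! ## §2 `a_q` odd iff `#Ẽ(𝔽_q)` odd iff no `2`-torsion mod `q` -/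

variable (W : WeierstrassCurve ℚ) [W.IsGloballyMinimal]

/-- For an odd prime `q`, `a_q = q + 1 − #Ẽ(𝔽_q)` (the tree's DEFINITION of `frobeniusTrace`) is odd
iff `#Ẽ(𝔽_q)` is odd. [folklore] -/
theorem odd_frobeniusTrace_iff_odd_reductionPointCount {q : ℕ} (hq : q.Prime) (hq2 : q ≠ 2) :
    Odd (W.frobeniusTrace q) ↔ Odd (W.reductionPointCount q) := by
  have hqodd : Odd q := hq.odd_of_ne_two hq2
  have hq1 : Even ((q : ℤ) + 1) := by
    obtain ⟨k, hk⟩ := hqodd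
    exact ⟨k + 1, by push_cast [hk]; ring⟩
  have hno : ¬ Odd ((q : ℤ) + 1) := Int.not_odd_iff_even.mpr hq1
  unfold WeierstrassCurve.frobeniusTrace
  rw [Int.odd_sub]
  constructor
  · intro h
    have hne : ¬ Even ((W.reductionPointCount q : ℕ) : ℤ) := fun hE => hno (h.mpr hE)
    exact_mod_cast Int.not_even_iff_odd.mp hne
  · intro hN
    have hN' : ¬ Even ((W.reductionPointCount q : ℕ) : ℤ) :=
      Int.not_even_iff_odd.mpr (by exact_mod_cast hN)
    exact ⟨fun ho => absurd ho hno, fun hE => absurd hE hN'⟩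

/-- **THE DICTIONARY (INGREDIENTS F9): Boxer–Diao's «`d` is 2-trivial for `E`» ⟺ «`a_q(E)` is odd
for every odd prime `q ∣ d`».** For a globally minimal `W/ℚ` and an integer `d`: the reduction
`Ẽ = reductionModPrime W q` has no `𝔽_q`-point of order `2` for every odd prime `q ∣ d`
(`BoxerDiao2010.IsTwoTrivial W d`) iff `W.frobeniusTrace q` is odd for every odd prime `q ∣ d` — because
`a_q = q + 1 − #Ẽ(𝔽_q)` by definition and a finite group has no element of order `2` iff its order is
odd. (At a prime `q ∤ 2N` of good reduction `frobeniusTrace` IS `a_q(E)`; the statement holds verbatim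
at bad odd `q` too, with the tree's convention `#Ẽ_ns`.) [cite: BoxerDiao2010, p. 1971 (definition of 2-trivial)]
[cite: KrizLi2019, Def. 4.1 (FMS) with p0014 L57–L58 (a_ℓ odd ⟺ Frob_ℓ of order 3)] -/
theorem isTwoTrivial_iff_forall_odd_frobeniusTrace (d : ℤ) :
    BoxerDiao2010.IsTwoTrivial W d ↔
      ∀ (q : ℕ), q.Prime → q ≠ 2 → (q : ℤ) ∣ d → Odd (W.frobeniusTrace q) := by
  constructor
  · intro h q hq hq2 hqd
    haveI : Fact q.Prime := ⟨hq⟩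
    haveI : NeZero q := ⟨hq.ne_zero⟩
    rw [odd_frobeniusTrace_iff_odd_reductionPointCount W hq hq2, reductionPointCount_eq_natCard_point]
    exact forall_two_nsmul_eq_zero_iff_odd_card.mp (h q hq2 hqd)
  · intro h q _ hq2 hqd
    haveI : NeZero q := ⟨(Fact.out : q.Prime).ne_zero⟩
    have hodd := h q Fact.out hq2 hqd
    rw [odd_frobeniusTrace_iff_odd_reductionPointCount W Fact.out hq2,
      reductionPointCount_eq_natCard_point] at hodd
    exact forall_two_nsmul_eq_zero_iff_odd_card.mpr hodd

end Summit.BirchSwinnertonDyer.Uniform.U2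

end
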